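import Summits.SmoothPoincare4.SmoothPoincare4.Theses.InformationMetricHadamard

/-!
# Stub `stub_nearestPointSpread` of line `core-distance-morse` — auxiliary file 2: vertical and level paths
(crux `InformationMetricHadamard.C0AhRecognition`, stmt-SmoothPoincare4-6015)

Two length comparisons for an end collar `Ψ : N × (0,1) → W⁵` whose metric `G ∘ dΨ` is within a
factor `1 ± ε` of the cone `c (dl² + gN)/l²` below height `t` (the crux's `C⁰`-asymptotics clause
at a fixed `ε`):

* `helper_nearestPointSpread_vertical` (registered helper) — **vertical cost from above**:
  `d_G(Ψ(y,λ₀), Ψ(y,s)) ≤ √((1+ε)c) · log(s/λ₀)` for `0 < λ₀ ≤ s < t` (length of the vertical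
  segment `l ↦ Ψ(y,l)`, whose velocity is `dΨ(0,1)`: `NearestPointSpread.mfderiv_vertical_apply`);
* `helper_nearestPointSpread_level` (registered helper) — **level comparison**:
  `d_G(Ψ(x₁,s), Ψ(x₂,s)) ≤ √((1+ε)c)/s · d_{gN}(x₁,x₂)` for `s < t` (push a `gN`-near-minimising
  `C¹` path `ξ` to the slice; the level path `τ ↦ Ψ(ξ τ, s)` has velocity `dΨ(ξ',0)`:
  `NearestPointSpread.mfderiv_level_apply`, `NearestPointSpread.length_level_le`).

The vertical lemmas are adapted from the lead's groundwork
`Cruxes/C0AhRecognition/PrepCollarLengthBounds.lean` (not importable from `Theorems`).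
Everything is proved (kind = proof); no definitions.
-/

noncomputable section

-- the prescribed namespace `Summit.<P>.<Sub>.…` duplicates `SmoothPoincare4` (P = Sub)
set_option linter.dupNamespace false

open scoped Manifold ContDiff Topology ENNReal NNReal
open Set Function MeasureTheory Bundle

namespace Summit.SmoothPoincare4.SmoothPoincare4.Cruxes.C0AhRecognition.CoreDistanceMorse

open Literature.Geometry.Lorentzian (PseudoRiemannianMetric)

namespace NearestPointSpread

variable {N : Type} [TopologicalSpace N] [ChartedSpace (EuclideanSpace ℝ (Fin 4)) N]
  [IsManifold (𝓡 4) ∞ N] {W : Type} [TopologicalSpace W] [ChartedSpace (EuclideanSpace ℝ (Fin 5)) W]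
  [IsManifold (𝓡 5) ∞ W]

/-- **Upper reading of the asymptotics clause.** If `|G(dΨ(v,σ), dΨ(v,σ)) − A| ≤ ε A` with
`A = c(σ² + gN(v,v))/l²`, then `G(dΨ(v,σ), dΨ(v,σ)) ≤ (1 + ε) A`. [folklore] -/
theorem le_add_mul_of_abs_sub_le {X A ε : ℝ} (h : |X - A| ≤ ε * A) : X ≤ (1 + ε) * A := by
  have h1 := (abs_sub_le_iff.1 h).1
  linarith

omit [IsManifold (𝓡 4) ∞ N] [IsManifold (𝓡 5) ∞ W] in
-- adapted from Cruxes/C0AhRecognition/PrepCollarLengthBounds.lean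
/-- The vertical collar line `l ↦ Ψ(y, l)` is `C^∞` on the open strip of heights `(0,1)` if `Ψ` is
`C^∞` on `N × (0,1)`. [folklore] -/
theorem contMDiffOn_vertical (Ψ : N × ℝ → W)
    (hsm : ContMDiffOn ((𝓡 4).prod 𝓘(ℝ, ℝ)) (𝓡 5) ∞ Ψ (univ ×ˢ Ioo (0 : ℝ) 1)) (y : N) :
    ContMDiffOn 𝓘(ℝ, ℝ) (𝓡 5) ∞ (fun l : ℝ ↦ Ψ (y, l)) (Ioo (0 : ℝ) 1) := by
  have hι : ContMDiff 𝓘(ℝ, ℝ) ((𝓡 4).prod 𝓘(ℝ, ℝ)) ∞ (fun l : ℝ ↦ ((y, l) : N × ℝ)) :=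
    contMDiff_const.prodMk contMDiff_id
  exact hsm.comp hι.contMDiffOn fun l hl ↦ ⟨mem_univ _, hl⟩

omit [IsManifold (𝓡 4) ∞ N] [IsManifold (𝓡 5) ∞ W] in
-- adapted from Cruxes/C0AhRecognition/PrepCollarLengthBounds.lean
/-- **Velocity of the vertical collar line**: `d/dl Ψ(y,l) = dΨ_{(y,l)}(0, 1)` at heights
`l ∈ (0,1)` (chain rule with the inclusion `l ↦ (y,l)`, whose differential is `1 ↦ (0,1)`).
[folklore] -/
theorem mfderiv_vertical_apply (Ψ : N × ℝ → W)
    (hsm : ContMDiffOn ((𝓡 4).prod 𝓘(ℝ, ℝ)) (𝓡 5) ∞ Ψ (univ ×ˢ Ioo (0 : ℝ) 1)) (y : N)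
    {l : ℝ} (hl : l ∈ Ioo (0 : ℝ) 1) :
    mfderiv 𝓘(ℝ, ℝ) (𝓡 5) (fun l : ℝ ↦ Ψ (y, l)) l 1 =
      mfderiv ((𝓡 4).prod 𝓘(ℝ, ℝ)) (𝓡 5) Ψ (y, l) ((0 : TangentSpace (𝓡 4) y), (1 : ℝ)) := by
  have hΩo : IsOpen (univ ×ˢ Ioo (0 : ℝ) 1 : Set (N × ℝ)) := isOpen_univ.prod isOpen_Ioo
  have hΨ : MDifferentiableAt ((𝓡 4).prod 𝓘(ℝ, ℝ)) (𝓡 5) Ψ (y, l) :=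
    (hsm.contMDiffAt (hΩo.mem_nhds ⟨mem_univ _, hl⟩)).mdifferentiableAt (by simp)
  have hι : HasMFDerivAt 𝓘(ℝ, ℝ) ((𝓡 4).prod 𝓘(ℝ, ℝ)) (fun l : ℝ ↦ ((y, l) : N × ℝ)) l
      ((0 : ℝ →L[ℝ] TangentSpace (𝓡 4) y).prod (ContinuousLinearMap.id ℝ ℝ)) :=
    (hasMFDerivAt_const y l).prodMk (hasMFDerivAt_id l)
  have hcomp : HasMFDerivAt 𝓘(ℝ, ℝ) (𝓡 5) (fun l : ℝ ↦ Ψ (y, l)) l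
      ((mfderiv ((𝓡 4).prod 𝓘(ℝ, ℝ)) (𝓡 5) Ψ (y, l)).comp
        ((0 : ℝ →L[ℝ] TangentSpace (𝓡 4) y).prod (ContinuousLinearMap.id ℝ ℝ))) :=
    (hΨ.hasMFDerivAt).comp l hι
  have heq := hcomp.mfderiv
  rw [heq]
  rfl

omit [IsManifold (𝓡 4) ∞ N] [IsManifold (𝓡 5) ∞ W] in
/-- **Velocity of a level path**: for a `C¹` path `ξ` in `N` and a height `s ∈ (0,1)`, the path
`τ ↦ Ψ(ξ τ, s)` on the slice has velocity `dΨ_{(ξ τ, s)}(ξ' τ, 0)` (chain rule with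
`τ ↦ (ξ τ, s)`, whose differential is `1 ↦ (ξ' τ, 0)`). [folklore] -/
theorem mfderiv_level_apply (Ψ : N × ℝ → W)
    (hsm : ContMDiffOn ((𝓡 4).prod 𝓘(ℝ, ℝ)) (𝓡 5) ∞ Ψ (univ ×ˢ Ioo (0 : ℝ) 1))
    {s : ℝ} (hs : s ∈ Ioo (0 : ℝ) 1) {ξ : ℝ → N} (hξ : ContMDiff 𝓘(ℝ, ℝ) (𝓡 4) 1 ξ) (τ : ℝ) :
    mfderiv 𝓘(ℝ, ℝ) (𝓡 5) (fun τ : ℝ ↦ Ψ (ξ τ, s)) τ 1 =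
      mfderiv ((𝓡 4).prod 𝓘(ℝ, ℝ)) (𝓡 5) Ψ (ξ τ, s) (mfderiv 𝓘(ℝ, ℝ) (𝓡 4) ξ τ 1, (0 : ℝ)) := by
  have hΩo : IsOpen (univ ×ˢ Ioo (0 : ℝ) 1 : Set (N × ℝ)) := isOpen_univ.prod isOpen_Ioo
  have hΨ : MDifferentiableAt ((𝓡 4).prod 𝓘(ℝ, ℝ)) (𝓡 5) Ψ (ξ τ, s) :=
    (hsm.contMDiffAt (hΩo.mem_nhds ⟨mem_univ _, hs⟩)).mdifferentiableAt (by simp)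
  have hξτ : HasMFDerivAt 𝓘(ℝ, ℝ) (𝓡 4) ξ τ (mfderiv 𝓘(ℝ, ℝ) (𝓡 4) ξ τ) :=
    ((hξ τ).mdifferentiableAt one_ne_zero).hasMFDerivAt
  have hι : HasMFDerivAt 𝓘(ℝ, ℝ) ((𝓡 4).prod 𝓘(ℝ, ℝ)) (fun τ : ℝ ↦ ((ξ τ, s) : N × ℝ)) τ
      ((mfderiv 𝓘(ℝ, ℝ) (𝓡 4) ξ τ).prod (0 : TangentSpace 𝓘(ℝ, ℝ) τ →L[ℝ] TangentSpace 𝓘(ℝ, ℝ) s)) :=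
    hξτ.prodMk (hasMFDerivAt_const s τ)
  have hcomp : HasMFDerivAt 𝓘(ℝ, ℝ) (𝓡 5) (fun τ : ℝ ↦ Ψ (ξ τ, s)) τ
      ((mfderiv ((𝓡 4).prod 𝓘(ℝ, ℝ)) (𝓡 5) Ψ (ξ τ, s)).comp
        ((mfderiv 𝓘(ℝ, ℝ) (𝓡 4) ξ τ).prod
          (0 : TangentSpace 𝓘(ℝ, ℝ) τ →L[ℝ] TangentSpace 𝓘(ℝ, ℝ) s))) :=
    hΨ.hasMFDerivAt.comp τ hι
  rw [hcomp.mfderiv]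
  rfl

/-- **Length of a level path.** If the asymptotics clause holds with constant `ε ≥ 0` below
height `t ≤ 1` and `s ∈ (0,t)`, then for a `C¹` path `ξ` in `N` the level path `τ ↦ Ψ(ξ τ, s)`
has `G`-length at most `√((1+ε)c)/s` times the `gN`-length of `ξ`: pointwise
`|dΨ(ξ',0)|_G ≤ √((1+ε)c)/s · |ξ'|_{gN}` (the clause at `(v,σ) = (ξ',0)`), then integrate.
[folklore] -/
theorem length_level_le (Ψ : N × ℝ → W)
    (gN : PseudoRiemannianMetric (𝓡 4) ∞ (EuclideanSpace ℝ (Fin 4)) (TangentSpace (𝓡 4) : N → Type _))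
    (hgN : gN.IsRiemannian)
    (G : PseudoRiemannianMetric (𝓡 5) ∞ (EuclideanSpace ℝ (Fin 5)) (TangentSpace (𝓡 5) : W → Type _))
    (hG : G.IsRiemannian)
    (hsm : ContMDiffOn ((𝓡 4).prod 𝓘(ℝ, ℝ)) (𝓡 5) ∞ Ψ (univ ×ˢ Ioo (0 : ℝ) 1))
    {c ε t : ℝ} (hc : 0 < c) (hε : 0 ≤ ε) (ht1 : t ≤ 1)
    (hasym : ∀ (y : N) (l : ℝ), l ∈ Ioo (0 : ℝ) t → ∀ (v : TangentSpace (𝓡 4) y) (σ : ℝ),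
      |G.val (Ψ (y, l)) (mfderiv ((𝓡 4).prod 𝓘(ℝ, ℝ)) (𝓡 5) Ψ (y, l) (v, σ))
          (mfderiv ((𝓡 4).prod 𝓘(ℝ, ℝ)) (𝓡 5) Ψ (y, l) (v, σ)) -
        c * (σ ^ 2 + gN.val y v v) / l ^ 2| ≤ ε * (c * (σ ^ 2 + gN.val y v v) / l ^ 2))
    {s : ℝ} (hs : s ∈ Ioo (0 : ℝ) t) {ξ : ℝ → N} (hξ : ContMDiff 𝓘(ℝ, ℝ) (𝓡 4) 1 ξ) (a b : ℝ) :
    G.length hG (fun τ : ℝ ↦ Ψ (ξ τ, s)) a b ≤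
      ENNReal.ofReal (Real.sqrt ((1 + ε) * c) / s) * gN.length hgN ξ a b := by
  have hs1 : s ∈ Ioo (0 : ℝ) 1 := ⟨hs.1, hs.2.trans_le ht1⟩
  have hκ : 0 ≤ Real.sqrt ((1 + ε) * c) / s := div_nonneg (Real.sqrt_nonneg _) hs.1.le
  rw [PseudoRiemannianMetric.length_eq_lintegral, PseudoRiemannianMetric.length_eq_lintegral,
    ← lintegral_const_mul' _ _ ENNReal.ofReal_ne_top]
  refine lintegral_mono fun τ ↦ ?_
  rw [← ENNReal.ofReal_mul hκ]
  refine ENNReal.ofReal_le_ofReal ?_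
  rw [mfderiv_level_apply Ψ hsm hs1 hξ τ]
  set v := mfderiv 𝓘(ℝ, ℝ) (𝓡 4) ξ τ 1 with hv
  have h := hasym (ξ τ) s hs v 0
  simp only [ne_eq, OfNat.ofNat_ne_zero, not_false_eq_true, zero_pow, zero_add] at h
  have hup := le_add_mul_of_abs_sub_le h
  have hA : (1 + ε) * (c * gN.val (ξ τ) v v / s ^ 2) =
      (Real.sqrt ((1 + ε) * c) / s) ^ 2 * gN.val (ξ τ) v v := by
    rw [div_pow, Real.sq_sqrt (by positivity)]
    field_simp
  rw [hA] at hup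
  calc Real.sqrt _ ≤ Real.sqrt ((Real.sqrt ((1 + ε) * c) / s) ^ 2 * gN.val (ξ τ) v v) :=
        Real.sqrt_le_sqrt hup
    _ = Real.sqrt ((1 + ε) * c) / s * Real.sqrt (gN.val (ξ τ) v v) := by
        rw [Real.sqrt_mul (sq_nonneg _), Real.sqrt_sq hκ]

end NearestPointSpread

open NearestPointSpread

-- adapted from Cruxes/C0AhRecognition/PrepCollarLengthBounds.lean (`edist_vertical_le`)
/-- **Vertical cost from above.** If the asymptotics clause holds with constant `ε ≥ 0` below
height `t ≤ 1` and `0 < λ₀ ≤ s < t`, then `d_G(Ψ(y,λ₀), Ψ(y,s)) ≤ √((1+ε)c)·log(s/λ₀)`: the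
vertical segment has `G`-speed `≤ √((1+ε)c)/l` at height `l` (the clause at `(v,σ) = (0,1)`,
using `gN(0,0) = 0`), and `∫_{λ₀}^{s} dl/l = log(s/λ₀)`. [folklore] -/
theorem helper_nearestPointSpread_vertical
    (N : Type) [TopologicalSpace N] [ChartedSpace (EuclideanSpace ℝ (Fin 4)) N] [IsManifold (𝓡 4) ∞ N]
    (gN : PseudoRiemannianMetric (𝓡 4) ∞ (EuclideanSpace ℝ (Fin 4)) (TangentSpace (𝓡 4) : N → Type _))
    (W : Type) [TopologicalSpace W] [ChartedSpace (EuclideanSpace ℝ (Fin 5)) W] [IsManifold (𝓡 5) ∞ W]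
    (G : PseudoRiemannianMetric (𝓡 5) ∞ (EuclideanSpace ℝ (Fin 5)) (TangentSpace (𝓡 5) : W → Type _))
    (hG : G.IsRiemannian) (c : ℝ) (Ψ : N × ℝ → W) (hc : 0 < c)
    (hsm : ContMDiffOn ((𝓡 4).prod 𝓘(ℝ, ℝ)) (𝓡 5) ∞ Ψ (univ ×ˢ Ioo (0 : ℝ) 1))
    (ε t : ℝ) (hε : 0 ≤ ε) (ht1 : t ≤ 1)
    (hasym : ∀ (y : N) (l : ℝ), l ∈ Ioo (0 : ℝ) t → ∀ (v : TangentSpace (𝓡 4) y) (σ : ℝ),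
      |G.val (Ψ (y, l)) (mfderiv ((𝓡 4).prod 𝓘(ℝ, ℝ)) (𝓡 5) Ψ (y, l) (v, σ))
          (mfderiv ((𝓡 4).prod 𝓘(ℝ, ℝ)) (𝓡 5) Ψ (y, l) (v, σ)) -
        c * (σ ^ 2 + gN.val y v v) / l ^ 2| ≤ ε * (c * (σ ^ 2 + gN.val y v v) / l ^ 2))
    (y : N) (lam0 s : ℝ) (h0 : 0 < lam0) (hls : lam0 ≤ s) (hst : s < t) :
    G.edist hG (Ψ (y, lam0)) (Ψ (y, s)) ≤
      ENNReal.ofReal (Real.sqrt ((1 + ε) * c) * Real.log (s / lam0)) := by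
  set γ : ℝ → W := fun l ↦ Ψ (y, l) with hγ
  have hs0 : 0 < s := h0.trans_le hls
  -- `γ` is `C¹` on `[λ₀, s] ⊂ (0,1)`
  have hIcc : Icc lam0 s ⊆ Ioo (0 : ℝ) 1 :=
    fun l hl ↦ ⟨h0.trans_le hl.1, (hl.2.trans_lt hst).trans_le ht1⟩
  have hγ1 : ContMDiffOn 𝓘(ℝ, ℝ) (𝓡 5) 1 γ (Icc lam0 s) :=
    ((contMDiffOn_vertical Ψ hsm y).of_le (by simp)).mono hIcc
  -- distance ≤ length = ∫ speed
  refine (PseudoRiemannianMetric.edist_le_length hG hls hγ1).trans ?_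
  rw [PseudoRiemannianMetric.length_eq_lintegral]
  -- pointwise speed bound `√(G(γ',γ')) ≤ √((1+ε)c)/l` on `[λ₀, s]`
  have hspeed : ∀ l ∈ Icc lam0 s,
      Real.sqrt (G.val (γ l) (mfderiv 𝓘(ℝ, ℝ) (𝓡 5) γ l 1) (mfderiv 𝓘(ℝ, ℝ) (𝓡 5) γ l 1)) ≤
        Real.sqrt ((1 + ε) * c) / l := by
    intro l hl
    have hl0 : 0 < l := h0.trans_le hl.1
    have hlt : l ∈ Ioo (0 : ℝ) t := ⟨hl0, hl.2.trans_lt hst⟩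
    rw [hγ, mfderiv_vertical_apply Ψ hsm y (hIcc hl)]
    have h := hasym y l hlt 0 1
    simp only [map_zero, add_zero, one_pow, mul_one] at h
    have hup := le_add_mul_of_abs_sub_le h
    have hA : (1 + ε) * (c / l ^ 2) = (Real.sqrt ((1 + ε) * c) / l) ^ 2 := by
      rw [div_pow, Real.sq_sqrt (by positivity)]
      ring
    rw [hA] at hup
    calc Real.sqrt _ ≤ Real.sqrt ((Real.sqrt ((1 + ε) * c) / l) ^ 2) := Real.sqrt_le_sqrt hup
      _ = Real.sqrt ((1 + ε) * c) / l := Real.sqrt_sq (by positivity)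
  -- integrate
  have hmeas : MeasurableSet (Icc lam0 s) := measurableSet_Icc
  calc ∫⁻ l in Icc lam0 s, ENNReal.ofReal (Real.sqrt (G.val (γ l) (mfderiv 𝓘(ℝ, ℝ) (𝓡 5) γ l 1)
          (mfderiv 𝓘(ℝ, ℝ) (𝓡 5) γ l 1)))
      ≤ ∫⁻ l in Icc lam0 s, ENNReal.ofReal (Real.sqrt ((1 + ε) * c) / l) :=
        setLIntegral_mono' hmeas fun l hl ↦ ENNReal.ofReal_le_ofReal (hspeed l hl)
    _ = ENNReal.ofReal (∫ l in Icc lam0 s, Real.sqrt ((1 + ε) * c) / l) := by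
        rw [ofReal_integral_eq_lintegral_ofReal]
        · refine (ContinuousOn.integrableOn_Icc ?_)
          exact continuousOn_const.div continuousOn_id fun l hl ↦ (h0.trans_le hl.1).ne'
        · exact (ae_restrict_iff' hmeas).2 (ae_of_all _ fun l hl ↦
            div_nonneg (Real.sqrt_nonneg _) (h0.le.trans hl.1))
    _ = ENNReal.ofReal (Real.sqrt ((1 + ε) * c) * Real.log (s / lam0)) := by
        congr 1
        rw [integral_Icc_eq_integral_Ioc, ← intervalIntegral.integral_of_le hls]
        simp_rw [div_eq_mul_inv]
        rw [intervalIntegral.integral_const_mul, integral_inv_of_pos h0 hs0, div_eq_mul_inv]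

/-- **Distance between two points of a slice (level comparison).** If the asymptotics clause holds
with constant `ε ≥ 0` below height `t ≤ 1` and `s ∈ (0,t)`, then
`d_G(Ψ(x₁,s), Ψ(x₂,s)) ≤ √((1+ε)c)/s · d_{gN}(x₁,x₂)`: push a `gN`-near-minimising `C¹` path
from `x₁` to `x₂` to the slice and use `length_level_le`; then let the slack tend to `0`.
[folklore] -/
theorem helper_nearestPointSpread_level
    (N : Type) [TopologicalSpace N] [ChartedSpace (EuclideanSpace ℝ (Fin 4)) N] [IsManifold (𝓡 4) ∞ N]
    (gN : PseudoRiemannianMetric (𝓡 4) ∞ (EuclideanSpace ℝ (Fin 4)) (TangentSpace (𝓡 4) : N → Type _))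
    (hgN : gN.IsRiemannian)
    (W : Type) [TopologicalSpace W] [ChartedSpace (EuclideanSpace ℝ (Fin 5)) W] [IsManifold (𝓡 5) ∞ W]
    (G : PseudoRiemannianMetric (𝓡 5) ∞ (EuclideanSpace ℝ (Fin 5)) (TangentSpace (𝓡 5) : W → Type _))
    (hG : G.IsRiemannian) (c : ℝ) (Ψ : N × ℝ → W) (hc : 0 < c)
    (hsm : ContMDiffOn ((𝓡 4).prod 𝓘(ℝ, ℝ)) (𝓡 5) ∞ Ψ (univ ×ˢ Ioo (0 : ℝ) 1))
    (ε t : ℝ) (hε : 0 ≤ ε) (ht1 : t ≤ 1)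
    (hasym : ∀ (y : N) (l : ℝ), l ∈ Ioo (0 : ℝ) t → ∀ (v : TangentSpace (𝓡 4) y) (σ : ℝ),
      |G.val (Ψ (y, l)) (mfderiv ((𝓡 4).prod 𝓘(ℝ, ℝ)) (𝓡 5) Ψ (y, l) (v, σ))
          (mfderiv ((𝓡 4).prod 𝓘(ℝ, ℝ)) (𝓡 5) Ψ (y, l) (v, σ)) -
        c * (σ ^ 2 + gN.val y v v) / l ^ 2| ≤ ε * (c * (σ ^ 2 + gN.val y v v) / l ^ 2))
    (s : ℝ) (hs : s ∈ Ioo (0 : ℝ) t) (x₁ x₂ : N) :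
    G.edist hG (Ψ (x₁, s)) (Ψ (x₂, s)) ≤
      ENNReal.ofReal (Real.sqrt ((1 + ε) * c) / s) * gN.edist hgN x₁ x₂ := by
  have hs1 : s ∈ Ioo (0 : ℝ) 1 := ⟨hs.1, hs.2.trans_le ht1⟩
  have hκ0 : 0 < Real.sqrt ((1 + ε) * c) / s := div_pos (Real.sqrt_pos.2 (by positivity)) hs.1
  set C : ℝ≥0∞ := ENNReal.ofReal (Real.sqrt ((1 + ε) * c) / s) with hC
  have hC0 : C ≠ 0 := (ENNReal.ofReal_pos.2 hκ0).ne'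
  rcases eq_or_ne (gN.edist hgN x₁ x₂) ⊤ with htop | hfin
  · rw [htop, ENNReal.mul_top hC0]; exact le_top
  refine ENNReal.le_of_forall_pos_le_add fun e he _ ↦ ?_
  -- a `gN`-near-minimising `C¹` path from `x₁` to `x₂`, with slack `e' = e / C`
  set e' : ℝ := (e : ℝ) / (Real.sqrt ((1 + ε) * c) / s) with he'
  have he'0 : 0 < e' := div_pos (by exact_mod_cast he) hκ0
  have hXe : Real.sqrt ((1 + ε) * c) / s * e' = e := by
    rw [he']
    exact mul_div_cancel₀ _ hκ0.ne'
  letI := gN.riemannianBundle hgN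
  have hlt : Manifold.riemannianEDist (𝓡 4) x₁ x₂ < gN.edist hgN x₁ x₂ + ENNReal.ofReal e' :=
    ENNReal.lt_add_right hfin (ENNReal.ofReal_pos.2 he'0).ne'
  obtain ⟨ξ, hξ0, hξ1, hξsm, hξlen, -⟩ :=
    Manifold.exists_lt_locally_constant_of_riemannianEDist_lt hlt zero_lt_one
  -- the level path `τ ↦ Ψ(ξ τ, s)` is `C¹` and joins `Ψ(x₁,s)` to `Ψ(x₂,s)`
  have hlev : ContMDiff 𝓘(ℝ, ℝ) (𝓡 5) 1 (fun τ : ℝ ↦ Ψ (ξ τ, s)) :=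
    (hsm.of_le (by exact_mod_cast le_top)).comp_contMDiff (hξsm.prodMk contMDiff_const)
      fun τ ↦ ⟨mem_univ _, hs1⟩
  have h1 := PseudoRiemannianMetric.edist_le_length hG zero_le_one (hlev.contMDiffOn (s := Icc 0 1))
  rw [hξ0, hξ1] at h1
  calc G.edist hG (Ψ (x₁, s)) (Ψ (x₂, s)) ≤ G.length hG (fun τ : ℝ ↦ Ψ (ξ τ, s)) 0 1 := h1
    _ ≤ C * gN.length hgN ξ 0 1 := length_level_le Ψ gN hgN G hG hsm hc hε ht1 hasym hs hξsm 0 1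
    _ ≤ C * (gN.edist hgN x₁ x₂ + ENNReal.ofReal e') := by gcongr; exact hξlen.le
    _ = C * gN.edist hgN x₁ x₂ + e := by
        rw [mul_add, hC, ← ENNReal.ofReal_mul hκ0.le, hXe, ENNReal.ofReal_coe_nnreal]

end Summit.SmoothPoincare4.SmoothPoincare4.Cruxes.C0AhRecognition.CoreDistanceMorse

end
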